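import Summits.FinalStateConjecture.FinalStateConjecture.Theorems.ClusterCompletenessOmegaLimitMultiKerrDefs
import HarnessLib

/-!
# Crux `LinearToNonlinearCapture` (stmt-FinalStateConjecture-14526), line `Sketch` — the route
# target splits by the number of holes: `X ↔ (N = 0 column) ∧ (N ≥ 1 column)`, Theses-free

Lead prover c3 (cycle 4), 2026-08-16. The crux is `AdiabaticMultiKerrILED → RecurrentMultiKerrCapture`
(route `ClusterCompleteness`, rev 20); the engine is formally inert, so the crux is the target
`X = RecurrentMultiKerrCapture` modulo it. Over the landed vocabulary of
`ClusterCompletenessOmegaLimitMultiKerrDefs` the matrix of `X` is `Recurs k 𝒟 → Settles 𝒟`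
(definitionally). This file lands, as importable sorry-free tree facts (no `Theses` import, so a
future closer of the crux or of the target can use them without an import cycle), the first
layer of the reduction worked out in the crux workfile `Cruxes/LinearToNonlinearCapture/Lines/Sketch.lean`
(reshapes 2–6):

* `recurrentMultiKerrCapture_of_flat_of_pos` — the matrix of `X` follows from (i) its `N = 0`
  column, stated VERBATIM as the matrix of the route item `RecurrentlyFlatDisperses`
  (stmt-FinalStateConjecture-14665: an anchored flat late chart on the whole late half-space on
  which `Cᵏ`-flatness recurs ⇒ the development settles down), and (ii) its `N ≥ 1` column (the
  recur interface with `n + 1` holes ⇒ `Settles`): work at the larger of the two orders (the recur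
  interface is antitone in the order) and split on the number of holes; for `N = 0` the
  hole-indexed clauses are vacuous and the unions over `Fin 0` are empty (the bookkeeping of the
  landed `stub_flatColumn_of_recurrentlyFlatDisperses`, p109782, redone here without the route import).
* `flat_of_recurrentMultiKerrCapture` — conversely the matrix of `X` gives the `N = 0` column (a
  flat-chart-only witness is a recur witness with `N := 0`, `Fin.elim0` everywhere; the
  planner's certificate `x_imp_b`), and
* `pos_of_recurrentMultiKerrCapture` — the `N ≥ 1` column (specialise `N := n + 1`).

Hence `X ↔ (N = 0 column) ∧ (N ≥ 1 column)`, kernel-checked, the first conjunct being the route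
item stmt-FinalStateConjecture-14665 by name up to unfolding (bridge file
`ClusterCompletenessLinearToNonlinearCaptureColumnsBridge.lean`). The `N ≥ 1` column splits
further into the registered stubs `stub_captureSettles_pos` (settling half) and
`stub_scriOfSettles_pos` (complete `𝓘⁺` given settling) of line `Sketch`. Pure logic over the
Statement's vocabulary; no analysis, no definition, no named fact. Shape of the statements:
Dafermos–Luk arXiv:1710.01722, §1.2.1 and Conjecture 1; DHRT arXiv:2104.08222, §1.
-/

namespace Summit.FinalStateConjecture.FinalStateConjecture.Theorems

open scoped Topology Manifold ENNReal ContDiff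
open Filter Set Function TopologicalSpace
open Literature.Geometry.Lorentzian
open Summit.FinalStateConjecture.FinalStateConjecture.Theorems.ClusterCompleteness

/-- **The target from its two columns by number of holes.** If (i) for some order every maximal
vacuum Cauchy development of admissible data carrying an anchored flat late chart on the whole
late half-space on which `Cᵏ`-flatness recurs has complete `𝓘⁺` and settles down (verbatim the
matrix of the route item `RecurrentlyFlatDisperses`), and (ii) for some order every such
development satisfying the recur interface with `n + 1 ≥ 1` holes settles down, then for some
order every maximal development that recurs (`Recurs k 𝒟`, any number of holes) settles down —
the matrix of the route target `RecurrentMultiKerrCapture`. Registered sub-goal of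
stmt-FinalStateConjecture-14526 (line `Sketch`, lead c3). -/
theorem recurrentMultiKerrCapture_of_flat_of_pos
    (h₀ : ∃ k : ℕ, ∀ (X : Type) [TopologicalSpace X] [ChartedSpace E3 X] [IsManifold (𝓡 3) ∞ X]
      [T2Space X] [SecondCountableTopology X] [ConnectedSpace X],
      ∀ D ∈ admissibleVacuumData X, ∀ 𝒟 : VacuumCauchyDevelopment D, 𝒟.IsMaximal →
      (∃ (O : Set 𝒟.carrier) (τ₀ : ℝ) (U₀ : Opens E4) (Ψ₀ : U₀ → 𝒟.carrier),
        𝒟.toSpacetime.IsLateChart (Minkowski.backgroundOn U₀) O τ₀ Ψ₀ ∧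
        {x : E4 | τ₀ < x 0} ⊆ (U₀ : Set E4) ∧
        O = Summit.FinalStateConjecture.exteriorOf 𝒟.toCauchyDevelopment
          (Ψ₀ '' (Minkowski.backgroundOn U₀).lateRegion τ₀) ∧
        (∀ τ₁ : ℝ, τ₀ < τ₁ → O \ Ψ₀ '' (Minkowski.backgroundOn U₀).lateRegion τ₁ ⊆
          𝒟.metric.causalPast 𝒟.timeOrientation
            (Ψ₀ '' (Minkowski.backgroundOn U₀).timeSlab τ₁)) ∧
        (∀ τ : ℝ, τ₀ < τ →
          𝒟.toSpacetime.deviationCk (Minkowski.backgroundOn U₀) Ψ₀ 0 τ ≤ ENNReal.ofReal (1 / 4)) ∧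
        ∀ ε : ℝ, 0 < ε → ∃ᶠ τ in atTop,
          𝒟.toSpacetime.deviationCk (Minkowski.backgroundOn U₀) Ψ₀ k τ ≤ ENNReal.ofReal ε) →
      (Summit.FinalStateConjecture.HasCompleteNullInfinity 𝒟.toCauchyDevelopment ∧
        ∃ (O : Set 𝒟.carrier) (d : FinalStateDecomposition 𝒟.toSpacetime O 2),
          (∀ i, Kerr.IsSubextremal (d.mass i) (d.spin i)) ∧
            O = Summit.FinalStateConjecture.exteriorOf 𝒟.toCauchyDevelopment d.charted ∧
              Summit.FinalStateConjecture.HasExhaustiveCharts d))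
    (h₁ : ∃ k : ℕ, ∀ (X : Type) [TopologicalSpace X] [ChartedSpace E3 X] [IsManifold (𝓡 3) ∞ X]
      [T2Space X] [SecondCountableTopology X] [ConnectedSpace X],
      ∀ D ∈ admissibleVacuumData X, ∀ 𝒟 : VacuumCauchyDevelopment D, 𝒟.IsMaximal →
      ∀ n : ℕ, (∃ (O : Set 𝒟.carrier) (M a : Fin (n + 1) → ℝ) (mo : Fin (n + 1) → lorentzGroup × E4) (τ₀ : ℝ)
        (Ψ : ∀ i, boostedKerrExterior (mo i).1 (mo i).2 (M i) (a i) → 𝒟.carrier)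
        (ρ R : Fin (n + 1) → ℝ → ℝ) (U₀ : Opens E4) (Ψ₀ : U₀ → 𝒟.carrier),
        (∀ i, Kerr.IsSubextremal (M i) (a i)) ∧
        (∀ i, 𝒟.toSpacetime.IsLateChart
          (boostedKerrBackground (mo i).1 (mo i).2 (M i) (a i)) O τ₀ (Ψ i)) ∧
        𝒟.toSpacetime.IsLateChart (Minkowski.backgroundOn U₀) O τ₀ Ψ₀ ∧
        (∀ i, Tendsto (fun t ↦ ρ i t / t) atTop (𝓝 0)) ∧
        (∀ i, Tendsto (R i) atTop atTop) ∧
        {x : E4 | τ₀ < x 0 ∧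
          ∀ i, ρ i (x 0) < Kerr.radius (a i) (poincareInv (mo i).1 (mo i).2 x)} ⊆ (U₀ : Set E4) ∧
        (∀ R' : ℝ, ∃ τ₁ : ℝ, Pairwise (Function.onFun Disjoint fun i ↦
          Ψ i '' (boostedKerrBackground (mo i).1 (mo i).2 (M i) (a i)).truncLateRegion τ₁ R')) ∧
        O = Summit.FinalStateConjecture.exteriorOf 𝒟.toCauchyDevelopment
          ((⋃ i, Ψ i '' (boostedKerrBackground (mo i).1 (mo i).2 (M i) (a i)).lateRegion τ₀) ∪
            Ψ₀ '' (Minkowski.backgroundOn U₀).lateRegion τ₀) ∧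
        (∀ τ₁ : ℝ, τ₀ < τ₁ →
          O \ (Ψ₀ '' (Minkowski.backgroundOn U₀).lateRegion τ₁ ∪
            ⋃ i, Ψ i '' {x | τ₁ < (boostedKerrBackground (mo i).1 (mo i).2 (M i) (a i)).time x.1 ∧
              (boostedKerrBackground (mo i).1 (mo i).2 (M i) (a i)).radius x.1 ≤
                R i ((boostedKerrBackground (mo i).1 (mo i).2 (M i) (a i)).time x.1)}) ⊆
          𝒟.metric.causalPast 𝒟.timeOrientation
            (Ψ₀ '' (Minkowski.backgroundOn U₀).timeSlab τ₁ ∪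
              ⋃ i, Ψ i '' (boostedKerrBackground (mo i).1 (mo i).2 (M i) (a i)).truncTimeSlab
                (R i τ₁) τ₁)) ∧
        (∀ τ : ℝ, τ₀ < τ →
          𝒟.toSpacetime.deviationCk (Minkowski.backgroundOn U₀) Ψ₀ 0 τ ≤ ENNReal.ofReal (1 / 4) ∧
            ∀ i, 𝒟.toSpacetime.truncDeviationCk
              (boostedKerrBackground (mo i).1 (mo i).2 (M i) (a i)) (Ψ i) 0 (R i τ) τ ≤
                ENNReal.ofReal (1 / 4)) ∧
        ∀ R' : ℝ, ∀ ε : ℝ, 0 < ε → ∃ᶠ τ in atTop,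
          𝒟.toSpacetime.deviationCk (Minkowski.backgroundOn U₀) Ψ₀ k τ ≤ ENNReal.ofReal ε ∧
            ∀ i, 𝒟.toSpacetime.truncDeviationCk
              (boostedKerrBackground (mo i).1 (mo i).2 (M i) (a i)) (Ψ i) k R' τ ≤
                ENNReal.ofReal ε) →
      Settles 𝒟) :
    ∃ k : ℕ, ∀ (X : Type) [TopologicalSpace X] [ChartedSpace E3 X] [IsManifold (𝓡 3) ∞ X]
      [T2Space X] [SecondCountableTopology X] [ConnectedSpace X],
      ∀ D ∈ admissibleVacuumData X, ∀ 𝒟 : VacuumCauchyDevelopment D, 𝒟.IsMaximal →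
      Recurs k 𝒟 → Settles 𝒟 := by
  obtain ⟨k₀, hk₀⟩ := h₀
  obtain ⟨k₁, hk₁⟩ := h₁
  refine ⟨max k₀ k₁, ?_⟩
  intro X _ _ _ _ _ _ D hD 𝒟 hmax hhyp
  obtain ⟨O, N, M, a, mo, τ₀, Ψ, ρ, R, U₀, Ψ₀, hsub, hΨ, hΨ₀, hρ, hR, hU₀, hsep, hO, hexh,
    hanchor, hrec⟩ := hhyp
  -- antitonicity of the recurrence clause in the order
  have hrec_of : ∀ k, k ≤ max k₀ k₁ → ∀ R' : ℝ, ∀ ε : ℝ, 0 < ε →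
      ∃ᶠ τ in atTop,
      𝒟.toSpacetime.deviationCk (Minkowski.backgroundOn U₀) Ψ₀ k τ ≤ ENNReal.ofReal ε ∧
        ∀ i, 𝒟.toSpacetime.truncDeviationCk
          (boostedKerrBackground (mo i).1 (mo i).2 (M i) (a i)) (Ψ i) k R' τ ≤
            ENNReal.ofReal ε := by
    intro k hk R' ε hε
    refine (hrec R' ε hε).mono fun τ hτ ↦ ⟨?_, fun i ↦ ?_⟩
    · exact (𝒟.toSpacetime.deviationCk_mono (Minkowski.backgroundOn U₀) Ψ₀ hk τ).trans hτ.1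
    · exact (supCkENorm_mono_right _ hk _).trans (hτ.2 i)
  cases N with
  | zero =>
    -- no hole: the hole-indexed clauses are vacuous, the unions over `Fin 0` are empty
    refine hk₀ X D hD 𝒟 hmax ⟨O, τ₀, U₀, Ψ₀, hΨ₀, ?_, ?_, ?_, ?_, ?_⟩
    · exact fun x hx ↦ hU₀ ⟨hx, fun i ↦ i.elim0⟩
    · rw [hO, Set.iUnion_of_empty, Set.empty_union]
    · intro τ₁ hτ₁
      have h := hexh τ₁ hτ₁
      rwa [Set.iUnion_of_empty, Set.union_empty, Set.iUnion_of_empty, Set.union_empty] at h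
    · exact fun τ hτ ↦ (hanchor τ hτ).1
    · exact fun ε hε ↦ (hrec_of k₀ (le_max_left _ _) 0 ε hε).mono fun τ hτ ↦ hτ.1
  | succ n =>
    exact hk₁ X D hD 𝒟 hmax n ⟨O, M, a, mo, τ₀, Ψ, ρ, R, U₀, Ψ₀, hsub, hΨ, hΨ₀, hρ, hR, hU₀,
      hsep, hO, hexh, hanchor, hrec_of k₁ (le_max_right _ _)⟩

/-- **The `N = 0` column from the target** (the planner's certificate `x_imp_b`, Theses-free): a
development with an anchored recurrently-flat late chart on the whole late half-space satisfies
the recur interface with `N := 0` holes (`Fin.elim0` for every hole-indexed datum; the excision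
and separation clauses are vacuous, the unions over `Fin 0` empty), so the matrix of
`RecurrentMultiKerrCapture` yields the matrix of `RecurrentlyFlatDisperses` at the same order. -/
theorem flat_of_recurrentMultiKerrCapture
    (h : ∃ k : ℕ, ∀ (X : Type) [TopologicalSpace X] [ChartedSpace E3 X] [IsManifold (𝓡 3) ∞ X]
      [T2Space X] [SecondCountableTopology X] [ConnectedSpace X],
      ∀ D ∈ admissibleVacuumData X, ∀ 𝒟 : VacuumCauchyDevelopment D, 𝒟.IsMaximal →
      Recurs k 𝒟 → Settles 𝒟) :
    ∃ k : ℕ, ∀ (X : Type) [TopologicalSpace X] [ChartedSpace E3 X] [IsManifold (𝓡 3) ∞ X]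
      [T2Space X] [SecondCountableTopology X] [ConnectedSpace X],
      ∀ D ∈ admissibleVacuumData X, ∀ 𝒟 : VacuumCauchyDevelopment D, 𝒟.IsMaximal →
      (∃ (O : Set 𝒟.carrier) (τ₀ : ℝ) (U₀ : Opens E4) (Ψ₀ : U₀ → 𝒟.carrier),
        𝒟.toSpacetime.IsLateChart (Minkowski.backgroundOn U₀) O τ₀ Ψ₀ ∧
        {x : E4 | τ₀ < x 0} ⊆ (U₀ : Set E4) ∧
        O = Summit.FinalStateConjecture.exteriorOf 𝒟.toCauchyDevelopment
          (Ψ₀ '' (Minkowski.backgroundOn U₀).lateRegion τ₀) ∧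
        (∀ τ₁ : ℝ, τ₀ < τ₁ → O \ Ψ₀ '' (Minkowski.backgroundOn U₀).lateRegion τ₁ ⊆
          𝒟.metric.causalPast 𝒟.timeOrientation
            (Ψ₀ '' (Minkowski.backgroundOn U₀).timeSlab τ₁)) ∧
        (∀ τ : ℝ, τ₀ < τ →
          𝒟.toSpacetime.deviationCk (Minkowski.backgroundOn U₀) Ψ₀ 0 τ ≤ ENNReal.ofReal (1 / 4)) ∧
        ∀ ε : ℝ, 0 < ε → ∃ᶠ τ in atTop,
          𝒟.toSpacetime.deviationCk (Minkowski.backgroundOn U₀) Ψ₀ k τ ≤ ENNReal.ofReal ε) →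
      (Summit.FinalStateConjecture.HasCompleteNullInfinity 𝒟.toCauchyDevelopment ∧
        ∃ (O : Set 𝒟.carrier) (d : FinalStateDecomposition 𝒟.toSpacetime O 2),
          (∀ i, Kerr.IsSubextremal (d.mass i) (d.spin i)) ∧
            O = Summit.FinalStateConjecture.exteriorOf 𝒟.toCauchyDevelopment d.charted ∧
              Summit.FinalStateConjecture.HasExhaustiveCharts d) := by
  obtain ⟨k, hk⟩ := h
  refine ⟨k, fun X _ _ _ _ _ _ D hD 𝒟 hmax hhyp ↦ ?_⟩
  obtain ⟨O, τ₀, U₀, Ψ₀, hΨ₀, hU₀, hO, hexh, hanchor, hrec⟩ := hhyp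
  refine hk X D hD 𝒟 hmax ⟨O, 0, Fin.elim0, Fin.elim0, Fin.elim0, τ₀, fun i ↦ i.elim0,
    Fin.elim0, Fin.elim0, U₀, Ψ₀, fun i ↦ i.elim0, fun i ↦ i.elim0, hΨ₀, fun i ↦ i.elim0,
    fun i ↦ i.elim0, fun x hx ↦ hU₀ hx.1, fun R' ↦ ⟨0, Subsingleton.pairwise⟩, ?_, ?_,
    fun τ hτ ↦ ⟨hanchor τ hτ, fun i ↦ i.elim0⟩,
    fun R' ε hε ↦ (hrec ε hε).mono fun τ hτ ↦ ⟨hτ, fun i ↦ i.elim0⟩⟩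
  · rw [Set.iUnion_of_empty, Set.empty_union]
    exact hO
  · intro τ₁ hτ₁
    rw [Set.iUnion_of_empty, Set.union_empty, Set.iUnion_of_empty, Set.union_empty]
    exact hexh τ₁ hτ₁

/-- **The `N ≥ 1` column from the target**: specialise the number of holes of the recur
interface to `n + 1`. Together with `flat_of_recurrentMultiKerrCapture` and
`recurrentMultiKerrCapture_of_flat_of_pos`: the target is EQUIVALENT to the conjunction of its
`N = 0` column (the route item `RecurrentlyFlatDisperses`) and its `N ≥ 1` column, so promoting
the latter (or its settling / complete-`𝓘⁺` halves, the registered stubs `stub_captureSettles_pos`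
/ `stub_scriOfSettles_pos` of line `Sketch`) to items is lossless. -/
theorem pos_of_recurrentMultiKerrCapture
    (h : ∃ k : ℕ, ∀ (X : Type) [TopologicalSpace X] [ChartedSpace E3 X] [IsManifold (𝓡 3) ∞ X]
      [T2Space X] [SecondCountableTopology X] [ConnectedSpace X],
      ∀ D ∈ admissibleVacuumData X, ∀ 𝒟 : VacuumCauchyDevelopment D, 𝒟.IsMaximal →
      Recurs k 𝒟 → Settles 𝒟) :
    ∃ k : ℕ, ∀ (X : Type) [TopologicalSpace X] [ChartedSpace E3 X] [IsManifold (𝓡 3) ∞ X]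
      [T2Space X] [SecondCountableTopology X] [ConnectedSpace X],
      ∀ D ∈ admissibleVacuumData X, ∀ 𝒟 : VacuumCauchyDevelopment D, 𝒟.IsMaximal →
      ∀ n : ℕ, (∃ (O : Set 𝒟.carrier) (M a : Fin (n + 1) → ℝ) (mo : Fin (n + 1) → lorentzGroup × E4) (τ₀ : ℝ)
        (Ψ : ∀ i, boostedKerrExterior (mo i).1 (mo i).2 (M i) (a i) → 𝒟.carrier)
        (ρ R : Fin (n + 1) → ℝ → ℝ) (U₀ : Opens E4) (Ψ₀ : U₀ → 𝒟.carrier),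
        (∀ i, Kerr.IsSubextremal (M i) (a i)) ∧
        (∀ i, 𝒟.toSpacetime.IsLateChart
          (boostedKerrBackground (mo i).1 (mo i).2 (M i) (a i)) O τ₀ (Ψ i)) ∧
        𝒟.toSpacetime.IsLateChart (Minkowski.backgroundOn U₀) O τ₀ Ψ₀ ∧
        (∀ i, Tendsto (fun t ↦ ρ i t / t) atTop (𝓝 0)) ∧
        (∀ i, Tendsto (R i) atTop atTop) ∧
        {x : E4 | τ₀ < x 0 ∧
          ∀ i, ρ i (x 0) < Kerr.radius (a i) (poincareInv (mo i).1 (mo i).2 x)} ⊆ (U₀ : Set E4) ∧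
        (∀ R' : ℝ, ∃ τ₁ : ℝ, Pairwise (Function.onFun Disjoint fun i ↦
          Ψ i '' (boostedKerrBackground (mo i).1 (mo i).2 (M i) (a i)).truncLateRegion τ₁ R')) ∧
        O = Summit.FinalStateConjecture.exteriorOf 𝒟.toCauchyDevelopment
          ((⋃ i, Ψ i '' (boostedKerrBackground (mo i).1 (mo i).2 (M i) (a i)).lateRegion τ₀) ∪
            Ψ₀ '' (Minkowski.backgroundOn U₀).lateRegion τ₀) ∧
        (∀ τ₁ : ℝ, τ₀ < τ₁ →
          O \ (Ψ₀ '' (Minkowski.backgroundOn U₀).lateRegion τ₁ ∪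
            ⋃ i, Ψ i '' {x | τ₁ < (boostedKerrBackground (mo i).1 (mo i).2 (M i) (a i)).time x.1 ∧
              (boostedKerrBackground (mo i).1 (mo i).2 (M i) (a i)).radius x.1 ≤
                R i ((boostedKerrBackground (mo i).1 (mo i).2 (M i) (a i)).time x.1)}) ⊆
          𝒟.metric.causalPast 𝒟.timeOrientation
            (Ψ₀ '' (Minkowski.backgroundOn U₀).timeSlab τ₁ ∪
              ⋃ i, Ψ i '' (boostedKerrBackground (mo i).1 (mo i).2 (M i) (a i)).truncTimeSlab
                (R i τ₁) τ₁)) ∧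
        (∀ τ : ℝ, τ₀ < τ →
          𝒟.toSpacetime.deviationCk (Minkowski.backgroundOn U₀) Ψ₀ 0 τ ≤ ENNReal.ofReal (1 / 4) ∧
            ∀ i, 𝒟.toSpacetime.truncDeviationCk
              (boostedKerrBackground (mo i).1 (mo i).2 (M i) (a i)) (Ψ i) 0 (R i τ) τ ≤
                ENNReal.ofReal (1 / 4)) ∧
        ∀ R' : ℝ, ∀ ε : ℝ, 0 < ε → ∃ᶠ τ in atTop,
          𝒟.toSpacetime.deviationCk (Minkowski.backgroundOn U₀) Ψ₀ k τ ≤ ENNReal.ofReal ε ∧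
            ∀ i, 𝒟.toSpacetime.truncDeviationCk
              (boostedKerrBackground (mo i).1 (mo i).2 (M i) (a i)) (Ψ i) k R' τ ≤
                ENNReal.ofReal ε) →
      Settles 𝒟 := by
  obtain ⟨k, hk⟩ := h
  refine ⟨k, fun X _ _ _ _ _ _ D hD 𝒟 hmax n hhyp ↦ ?_⟩
  obtain ⟨O, M, a, mo, τ₀, Ψ, ρ, R, U₀, Ψ₀, hrest⟩ := hhyp
  exact hk X D hD 𝒟 hmax ⟨O, n + 1, M, a, mo, τ₀, Ψ, ρ, R, U₀, Ψ₀, hrest⟩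

end Summit.FinalStateConjecture.FinalStateConjecture.Theorems
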